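import Summits.CriticalPhenomena.Ising3DConformalLimit.Theses.ArmHyperscaling
import Summits.CriticalPhenomena.Ising3DConformalLimit.Theorems.HyperoctahedralRPHRP2Rigidity
import Summits.CriticalPhenomena.Ising3DConformalLimit.Theorems.HyperoctahedralRPLimitRotationInvariant
import HarnessLib

/-!
# Crux `ArmHyperscaling.IsotropyFromOneArm` (stmt-CriticalPhenomena-15593) — line `landed-isotropy`
# (crux-strategist `planner-cstrat-stmt-CriticalPhenomena-15593-b1-0`, 2026-08-17): the crux is a THEOREM of the tree.

The crux reads `OneArmHyperscaling → (∀ ρ Δ S, (H1)–(H6) → IsRotationInvariant S)`.  Its consequent is, verbatim, the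
consequent of crux `HyperoctahedralRP.LimitRotationInvariant` (stmt-CriticalPhenomena-1980:
`HRP2Rigidity → ∀ ρ Δ S, (H1)–(H6) → IsRotationInvariant S`), which is PROVED
(`Cruxes.LimitRotationInvariant.QuarterTurnLiouville.limitRotationInvariant_proof`,
`Theorems/HyperoctahedralRPLimitRotationInvariant.lean`, closed 2026-08-16T22:39Z — through crux stmt-8367
`rotationUpgradeFromTwoPoint_proof`, closed 2026-08-16T22:36Z), and its antecedent `HRP2Rigidity` (stmt-CriticalPhenomena-1979)
is PROVED too (`Cruxes.HRP2Rigidity.XRayMellin.HRP2Rigidity_of`, `Theorems/HyperoctahedralRPHRP2Rigidity.lean`, closed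
2026-08-16T05:51Z).  Hence the STRENGTHENING S⁺ = "every normalised, non-degenerate, translation-invariant, scale-covariant
pointwise scaling limit of `criticalCorr 3` is `O(3)`-invariant" holds unconditionally, and the crux follows by weakening
(the one-arm hypothesis is not consumed).  No stubs: the composition below is sorry-free.

Consequence for the route (its own KILL CRITERIA, last sentence): crux 1980 was proved by another input than the one-arm
bound, so `OneArmHyperscaling` (stmt-15591) is no longer load-bearing for isotropy on route ArmHyperscaling — `closes` consumes
`hOA` only through `hRot`, which ignores it.  Tenure decision (supersede by HyperoctahedralRP / re-glue without 15591) is the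
route planner's, not this seat's.
-/

noncomputable section

open Literature.Probability.LatticeModels

namespace Summit.CriticalPhenomena.Ising3DConformalLimit.Cruxes.IsotropyFromOneArm.LandedIsotropy

/-- **S⁺ (the crux without its antecedent).**  Every normalised, non-degenerate, translation-invariant, scale-covariant
pointwise scaling limit of the critical `ℤ³` Ising correlators is `O(3)`-invariant at all orders:
`limitRotationInvariant_proof` (crux stmt-1980, landed) applied to `HRP2Rigidity_of` (crux stmt-1979, landed). -/
theorem isotropy_unconditional :
    ∀ (ρ : ℝ → ℝ) (Δ : ℝ) (S : CorrFamily 3), (∀ δ ∈ Set.Ioc (0:ℝ) 1, 0 < ρ δ) →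
      HasPointwiseScalingLimit (criticalCorr 3) ρ S → (∀ n z, z ∉ NonCoincident 3 n → S n z = 0) →
      IsNondegenerateTwoPoint S → IsTranslationInvariant S → IsScaleCovariant Δ S → IsRotationInvariant S :=
  _root_.Summit.CriticalPhenomena.Ising3DConformalLimit.Cruxes.LimitRotationInvariant.QuarterTurnLiouville.limitRotationInvariant_proof
    _root_.Summit.CriticalPhenomena.Ising3DConformalLimit.Cruxes.HRP2Rigidity.XRayMellin.HRP2Rigidity_of

/-- **`IsotropyFromOneArm_of`** — crux `ArmHyperscaling.IsotropyFromOneArm` (item stmt-CriticalPhenomena-15593) BY NAME,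
sorry-free: weakening of `isotropy_unconditional` by the (unused) one-arm hyperscaling antecedent. -/
theorem IsotropyFromOneArm_of :
    _root_.Summit.CriticalPhenomena.Ising3DConformalLimit.Theses.ArmHyperscaling.IsotropyFromOneArm :=
  fun _hOA => isotropy_unconditional

/-- Same theorem under the `<decl>_proof` naming used by the closing files of cruxes 1979/1980/8367. -/
theorem isotropyFromOneArm_proof :
    _root_.Summit.CriticalPhenomena.Ising3DConformalLimit.Theses.ArmHyperscaling.IsotropyFromOneArm :=
  IsotropyFromOneArm_of

end Summit.CriticalPhenomena.Ising3DConformalLimit.Cruxes.IsotropyFromOneArm.LandedIsotropy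

end
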